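import Summits.QuantumFields.BalabanUV.T4Continuum.Support.ShellMeasureLandauEndWindowRestrict

/-!
# `T4Continuum.ShellMeasureCoTestStarShaped` — audit γ3, THE COLLAR, CO-TEST SIDE: the neighbouring cubes' kept
# (2.17)-indicators are ADMISSIBLE co-test factors of the live-level END (`hJW`, `hJ`, `hJ1`) — centre-monotone by
# STAR-SHAPEDNESS, which follows from THEIR (AN-bound) + (SM) on OUR chart rays
(cell `pub-balaban`, sub-cell `t4`, spine estimate NE7c (node U5b); NE7c ROUND-2 crew, unit `b2b-balaban-t4-ne7c-formalise-leaf-01`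
gen 8; row **S94** of the owner's table `t4/b2b-balaban-t4-ne7c-p1/LEAVES-NE7c-P1.md` (owner GO R-ne7cp1-g33-6 (c) on this
seat's INTENT «γ3 COLLAR, THE CO-TEST SIDE»; companion of row S87) — the second half of this seat's XREAD INFO
C-ne7cleaf01g8-1, accepted by the owner as R-ne7cp1-g33-2 (b) (first half: S87 f5 `ShellMeasureWindowReachCollar` p229745,
the SUPPORT side); ADDITIVE —
imports leaf-03-g6's S87 f2 `ShellMeasureLandauEndWindowRestrict` (p229117: `classifier_lt_of_contraction`,
`exp_neg_smul_mem_closedBall`) ONLY; [folklore]; 0 `def`, 0 `def … : Prop`, 0 sorry, 0 citation tags)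

HONEST FRAMING.  Finite four-torus programme, rung (B)+1 only — NOT infinite volume, NOT a mass gap, NOT the Clay
problem, NOT summit progress; (B), `BetaPertHyp`, (B^μ) not consumed.  NE7c (`T4IndicatorShell.ShellWeightBound`) is NOT
PRINTED in [Balaban 1983–89] and NOT PROVED; «NE7c ⇐ the named binders» (trigger c3).  Nothing printed is asserted;
[Balaban1988Convergent] (2.16)∕(2.17) LOCATE the shapes; no estimate of Bałaban's is discharged.  This file is PLUMBING on
OUR side: indicator algebra plus ONE call of leaf-03's star-shapedness lemma per neighbour.  HONEST DEPENDENCY (cell):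
continuum YM on T⁴ ⇐ BetaPertH ∧ nine spine estimates (0/9 proved); BetaPertH ⇐ (D1) ∧ (D4) ∧ CAP+tail; G-an2-4 gates
asym, D1 and NE2/3/4.

THE POINT (R-ne7cp1-g33-2 (b), WALL-NE7c-P1 §2b row `Jco, hJW, hJ, hJ1, W`).  By the collar correction the window on the
collar `□^{∼4} ∖ □^∼` of the block comes from the NEIGHBOURING cubes' (2.17)-indicators `χ(□′)`, `□′^∼ ∩ □^{∼4} ≠ ∅`, KEPT as
factors of the slot's realized density.  S87 f5 ∕ f2b ∕ f4 wire the SUPPORT side.  But a kept factor must ALSO inhabit the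
END's co-test triple for `Jco` — supported in the window (`hJW`), at most one (`hJ1`), and CENTRE-MONOTONE along the chart
contraction `x ↦ e^{−a}•x` (`hJ`).  For a neighbour's indicator `𝟙{u_{□′}(section_V x) < θ′}` — a functional of ITS
localized minimiser `U_{k,□′}`, which DEPENDS on our block variables where the localization domains overlap — `hJ` is NOT
automatic: it is the STAR-SHAPEDNESS of the sub-threshold set `{x | u_{□′} ∘ section_V < θ′}` along our contraction.
So the bare binder `hJ` BECOMES «star-shapedness ⇐ the neighbours' (AN-bound) + (SM) on OUR rays» — a LOCATED input of the
SAME W-a family as the slot's own classifier data (the straddling cube's localized minimiser `U_{k,□′}` read along OUR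
block's chart contraction; R-ne7cp1-g33-6 (c)) — displayed here as binders, discharged by nobody.
leaf-03-g6 proved exactly this for the slot's OWN event (S87 f2 `classifier_lt_of_contraction`: (AN-bound) on the chart rays
+ (SM) ⟹ star-shaped, via the two-point interpolation `coreMap_of_interp`).  THIS FILE applies it PER NEIGHBOUR:
* §1 (generic real vector space): for a co-test `Jco x := (W ∩ ⋂_{i∈N} {x | v i x < θ i}).indicator 1 x` —
  `indicator_le_one`, `mem_of_indicator_ne_zero` (`hJ1`, `hJW`), and **`indicator_inter_le_of_starShaped`**: `W` star-shaped
  under the map `T` and every factor star-shaped on `W` ⟹ `Jco x ≤ Jco (T x)` (`hJ` at `T := (e^{−a} • ·)`).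
* §2 **`starShaped_of_classifier`**: the factor `v i := classifier (hPu i) (hol i)` IS star-shaped on any `W` on which, at
  every point, the (AN-bound) data in S73's shape and the smallness (SM)_i hold — ONE call of `classifier_lt_of_contraction`
  with `c := e^{−a} ∈ (0, 1]`.
* §3 **`jco_triple_of_neighbours`**: the END hosts' THREE binders LITERALLY (per exterior section `V`, `x : Fin m₀ → ℝ`) for
  `W V := closedBall 0 S` and `Jco V x := (closedBall 0 S ∩ ⋂_{i∈N} {x | classifier (hPu i) (hol i V) x < θ i}).indicator 1 x`,
  from the per-neighbour (AN-bound) families on the S-ball (V-uniform radius `R i > 1`, bound `H i`) and (SM)_i —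
  DISPLAYED binders, asserted by nobody; + `hWS` for free.
* §4 non-vacuity: the empty neighbour set (the bare window co-test) and a one-neighbour instance with the ZERO holonomy
  defect (`hol := 1`, classifier `≡ 0`, (AN) by the zero germ) — the binder family of §3 is jointly inhabited with `N ≠ ∅`.
WHAT THIS DOES NOT DO.  The per-neighbour (AN-bound) on OUR rays is a located input of the SAME W-a family as the own
classifier's (B11 Prop. 9 ∕ Props 2–4 TYPE for the neighbour's localized minimiser as a function of the shared block
variables; (2.16): `U_{k,□′}` depends on `V↾□′^{∼4}`) — displayed, NOT discharged; which neighbours a given (2.18)-term keeps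
((W1)∕`LiveWindow`; dropped ones go to SM-L6 (MR)_j, S86) is not decided here.  NOTHING in the countdown moves; NE7c NOT
PROVED; spine PROVED 0∕9.
-/

noncomputable section

open Set Metric

namespace Summit.QuantumFields.BalabanUV.T4Continuum.ShellMeasureCoTestStarShaped

open scoped ENNReal
open ShellMeasureLevelAssembly (classifier)
open ShellMeasureLandauEndWindowRestrict (classifier_lt_of_contraction exp_neg_smul_mem_closedBall)

/-! ## §1 Indicator co-tests: `≤ 1`, support, centre-monotonicity from star-shapedness -/

section Indicator

variable {X : Type*}

/-- an indicator co-test is at most one (`hJ1`). [folklore] -/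
theorem indicator_le_one (A : Set X) (x : X) : A.indicator (1 : X → ℝ≥0∞) x ≤ 1 := by
  by_cases hx : x ∈ A
  · rw [indicator_of_mem hx]; exact le_rfl
  · rw [indicator_of_notMem hx]; exact bot_le

/-- a nonzero indicator value locates the point in the set (`hJW` for `A ⊆ W`). [folklore] -/
theorem mem_of_indicator_ne_zero {A : Set X} {x : X} (h : A.indicator (1 : X → ℝ≥0∞) x ≠ 0) : x ∈ A := by
  by_contra hx
  exact h (indicator_of_notMem hx _)

/-- **CENTRE-MONOTONICITY FROM STAR-SHAPEDNESS.**  If `W` is mapped into itself by `T` and, on `W`, every factor's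
sub-threshold set is mapped into itself by `T` (`x ∈ W → v i x < θ i → v i (T x) < θ i`), then the co-test
`(W ∩ ⋂_{i∈N} {v i < θ i}).indicator 1` does not decrease under `T` — the END's `hJ` at `T := (e^{−a} • ·)`. [folklore] -/
theorem indicator_inter_le_of_starShaped {ι : Type*} (N : Finset ι) (W : Set X) (v : ι → X → ℝ) (θ : ι → ℝ)
    (T : X → X) (hW : ∀ x ∈ W, T x ∈ W) (hv : ∀ i ∈ N, ∀ x ∈ W, v i x < θ i → v i (T x) < θ i) (x : X) :
    (W ∩ ⋂ i ∈ N, {y | v i y < θ i}).indicator (1 : X → ℝ≥0∞) x ≤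
      (W ∩ ⋂ i ∈ N, {y | v i y < θ i}).indicator (1 : X → ℝ≥0∞) (T x) := by
  by_cases hx : x ∈ W ∩ ⋂ i ∈ N, {y | v i y < θ i}
  · have hxW : x ∈ W := hx.1
    have hxI : ∀ i ∈ N, v i x < θ i := fun i hi => by
      have h := hx.2
      simp only [mem_iInter, mem_setOf_eq] at h
      exact h i hi
    have hTx : T x ∈ W ∩ ⋂ i ∈ N, {y | v i y < θ i} := by
      refine ⟨hW x hxW, ?_⟩
      simp only [mem_iInter, mem_setOf_eq]
      exact fun i hi => hv i hi x hxW (hxI i hi)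
    rw [indicator_of_mem hx, indicator_of_mem hTx]; exact le_rfl
  · rw [indicator_of_notMem hx]; exact bot_le

end Indicator

/-! ## §2 A neighbour's classifier is star-shaped along our contraction, given its (AN-bound) + (SM) on our rays -/

section Classifier

variable {E : Type*} [AddCommGroup E] [Module ℝ E]
variable {A : Type*} [NormedRing A] [NormedAlgebra ℂ A] [CompleteSpace A]

/-- **STAR-SHAPEDNESS OF A NEIGHBOUR'S SUB-THRESHOLD SET.**  For the classifier `classifier hPu hol` of a (neighbouring)
cube read on OUR chart (`hol p x` = its localized minimiser's plaquette holonomy at the section `x`), if at every point of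
`W` the (AN-bound) data in S73's shape hold (radius `R > 1`, bound `H`) together with the smallness `36H∕(R−1)² ≤ δθ`
(`0 ≤ δ ≤ 1`, `θ > 0`), then for every `a ≥ 0`: `x ∈ W → classifier x < θ → classifier (e^{−a}•x) < θ`
(leaf-03-g6's `classifier_lt_of_contraction` at `c := e^{−a}`). [folklore] -/
theorem starShaped_of_classifier {ι : Type*} {Pu : Finset ι} (hPu : Pu.Nonempty) (hol : ι → E → A) (W : Set E)
    {R H θ δ : ℝ} (hR : 1 < R) (hθ : 0 < θ) (hδ0 : 0 ≤ δ) (hδ1 : δ ≤ 1) (hSM : 36 * H * 1 ^ 2 / (R - 1) ^ 2 ≤ δ * θ)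
    (hAN : ∀ x ∈ W, ∀ p ∈ Pu, ∃ f : ℂ → A, DifferentiableOn ℂ f (ball 0 R) ∧ (∀ w ∈ ball (0 : ℂ) R, ‖f w‖ ≤ H) ∧
      f 0 = 0 ∧ ∀ c : ℝ, 0 ≤ c → c ≤ 1 → f (c : ℂ) = hol p (c • x) - 1)
    {a : ℝ} (ha : 0 ≤ a) : ∀ x ∈ W, classifier hPu hol x < θ → classifier hPu hol (Real.exp (-a) • x) < θ :=
  fun x hx h1 => classifier_lt_of_contraction hPu hol hR hθ hδ0 hδ1 hSM (hAN x hx) h1 (Real.exp_pos _)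
    (by rw [Real.exp_le_one_iff]; linarith)

end Classifier

/-! ## §3 The END hosts' co-test triple for the neighbours' kept indicators -/

section Triple

variable {A : Type*} [NormedRing A] [NormedAlgebra ℂ A] [CompleteSpace A]

/-- **THE NEIGHBOURS' KEPT (2.17)-INDICATORS ARE ADMISSIBLE CO-TESTS.**  Exterior sections `V : 𝒱`, chart `Fin m₀ → ℝ`,
window `W V := closedBall 0 S`; a finite neighbour set `N`; per neighbour `i` a nonempty plaquette set `Pu i`, holonomies
`hol i V : Fin m₀ → ℝ → A` read on our chart, a threshold `θ i > 0`, and — DISPLAYED, V-uniform — the (AN-bound) data on the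
S-ball (radius `R i > 1`, bound `H i`) with (SM)_i `36H_i∕(R_i − 1)² ≤ δ_i θ_i`, `0 ≤ δ_i ≤ 1`.  Then the co-test
`Jco V x := (closedBall 0 S ∩ ⋂_{i∈N} {x | classifier (hPu i) (hol i V) x < θ i}).indicator 1 x` satisfies the END hosts'
three binders LITERALLY: `hJW : Jco V x ≠ 0 → x ∈ W V`, `hJ : 0 ≤ a → Jco V x ≤ Jco V (e^{−a}•x)`, `hJ1 : Jco V x ≤ 1`
(+ `hWS : W V ⊆ closedBall 0 S`). [folklore] -/
theorem jco_triple_of_neighbours {𝒱 : Type*} {m₀ : ℕ} {S : ℝ} {κ : Type*} (N : Finset κ) {ι : κ → Type*}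
    {Pu : (i : κ) → Finset (ι i)} (hPu : ∀ i, (Pu i).Nonempty) (hol : (i : κ) → 𝒱 → ι i → (Fin m₀ → ℝ) → A)
    {θ R H δ : κ → ℝ} (hR : ∀ i ∈ N, 1 < R i) (hθ : ∀ i ∈ N, 0 < θ i) (hδ0 : ∀ i ∈ N, 0 ≤ δ i) (hδ1 : ∀ i ∈ N, δ i ≤ 1)
    (hSM : ∀ i ∈ N, 36 * H i * 1 ^ 2 / (R i - 1) ^ 2 ≤ δ i * θ i)
    (hAN : ∀ i ∈ N, ∀ V, ∀ x ∈ closedBall (0 : Fin m₀ → ℝ) S, ∀ p ∈ Pu i, ∃ f : ℂ → A,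
      DifferentiableOn ℂ f (ball 0 (R i)) ∧ (∀ w ∈ ball (0 : ℂ) (R i), ‖f w‖ ≤ H i) ∧ f 0 = 0 ∧
      ∀ c : ℝ, 0 ≤ c → c ≤ 1 → f (c : ℂ) = hol i V p (c • x) - 1) :
    (∀ V x, (closedBall (0 : Fin m₀ → ℝ) S ∩ ⋂ i ∈ N, {y | classifier (hPu i) (hol i V) y < θ i}).indicator
        (1 : (Fin m₀ → ℝ) → ℝ≥0∞) x ≠ 0 → x ∈ closedBall (0 : Fin m₀ → ℝ) S) ∧
    (∀ V x, ∀ a : ℝ, 0 ≤ a →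
      (closedBall (0 : Fin m₀ → ℝ) S ∩ ⋂ i ∈ N, {y | classifier (hPu i) (hol i V) y < θ i}).indicator
          (1 : (Fin m₀ → ℝ) → ℝ≥0∞) x ≤
        (closedBall (0 : Fin m₀ → ℝ) S ∩ ⋂ i ∈ N, {y | classifier (hPu i) (hol i V) y < θ i}).indicator
          (1 : (Fin m₀ → ℝ) → ℝ≥0∞) (Real.exp (-a) • x)) ∧
    (∀ V x, (closedBall (0 : Fin m₀ → ℝ) S ∩ ⋂ i ∈ N, {y | classifier (hPu i) (hol i V) y < θ i}).indicator
        (1 : (Fin m₀ → ℝ) → ℝ≥0∞) x ≤ 1) ∧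
    (∀ _V : 𝒱, closedBall (0 : Fin m₀ → ℝ) S ⊆ closedBall (0 : Fin m₀ → ℝ) S) := by
  refine ⟨fun V x hx => (mem_of_indicator_ne_zero hx).1, fun V x a ha => ?_, fun V x => indicator_le_one _ x,
    fun _ => subset_rfl⟩
  exact indicator_inter_le_of_starShaped N (closedBall (0 : Fin m₀ → ℝ) S) (fun i => classifier (hPu i) (hol i V)) θ
    (fun y => Real.exp (-a) • y) (fun y hy => exp_neg_smul_mem_closedBall hy ha)
    (fun i hi => starShaped_of_classifier (hPu i) (hol i V) (closedBall 0 S) (hR i hi) (hθ i hi) (hδ0 i hi) (hδ1 i hi)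
      (hSM i hi) (hAN i hi V) ha) x

end Triple

/-! ## §4 Non-vacuity: the bare window (no neighbour) and one neighbour with a flat holonomy -/

section NonVacuity

/-- NO neighbour: the co-test is the bare window indicator, and the triple holds (nothing to check). [folklore] -/
example {m₀ : ℕ} {S : ℝ} :
    ∀ (V : Unit) (x : Fin m₀ → ℝ), ∀ a : ℝ, 0 ≤ a →
      (closedBall (0 : Fin m₀ → ℝ) S ∩ ⋂ i ∈ (∅ : Finset Unit), {y : Fin m₀ → ℝ |
          classifier (Finset.singleton_nonempty ()) (fun (_ : Unit) (_ : Fin m₀ → ℝ) => (1 : ℂ)) y < (fun _ => (1 : ℝ)) i}).indicator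
          (1 : (Fin m₀ → ℝ) → ℝ≥0∞) x ≤
        (closedBall (0 : Fin m₀ → ℝ) S ∩ ⋂ i ∈ (∅ : Finset Unit), {y : Fin m₀ → ℝ |
          classifier (Finset.singleton_nonempty ()) (fun (_ : Unit) (_ : Fin m₀ → ℝ) => (1 : ℂ)) y < (fun _ => (1 : ℝ)) i}).indicator
          (1 : (Fin m₀ → ℝ) → ℝ≥0∞) (Real.exp (-a) • x) :=
  (jco_triple_of_neighbours (𝒱 := Unit) (A := ℂ) (∅ : Finset Unit) (ι := fun _ => Unit)
    (Pu := fun _ => {()}) (fun _ => Finset.singleton_nonempty ()) (fun _ _ _ _ => (1 : ℂ))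
    (θ := fun _ => 1) (R := fun _ => 2) (H := fun _ => 0) (δ := fun _ => 0)
    (by simp) (by simp) (by simp) (by simp) (by simp) (by simp)).2.1

/-- **ONE neighbour, (x1)**: `N = {()}` NONEMPTY, one plaquette, the FLAT holonomy `hol ≡ 1` (classifier `≡ 0 < θ = 1`), the
(AN-bound) by the ZERO germ (`R = 2`, `H = 0`), (SM) `36·0∕1 ≤ 0·1`: every hypothesis of §3 holds JOINTLY, and the co-test is
the full window indicator — nonzero at the origin. [folklore] -/
theorem one_neighbour_inhabited {m₀ : ℕ} {S : ℝ} (hS : 0 ≤ S) :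
    (∀ (V : Unit) (x : Fin m₀ → ℝ), ∀ a : ℝ, 0 ≤ a →
      (closedBall (0 : Fin m₀ → ℝ) S ∩ ⋂ i ∈ ({()} : Finset Unit), {y : Fin m₀ → ℝ |
          classifier (Finset.singleton_nonempty ()) (fun (_ : Unit) (_ : Fin m₀ → ℝ) => (1 : ℂ)) y < (fun _ => (1 : ℝ)) i}).indicator
          (1 : (Fin m₀ → ℝ) → ℝ≥0∞) x ≤
        (closedBall (0 : Fin m₀ → ℝ) S ∩ ⋂ i ∈ ({()} : Finset Unit), {y : Fin m₀ → ℝ |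
          classifier (Finset.singleton_nonempty ()) (fun (_ : Unit) (_ : Fin m₀ → ℝ) => (1 : ℂ)) y < (fun _ => (1 : ℝ)) i}).indicator
          (1 : (Fin m₀ → ℝ) → ℝ≥0∞) (Real.exp (-a) • (x : Fin m₀ → ℝ))) ∧
    (closedBall (0 : Fin m₀ → ℝ) S ∩ ⋂ i ∈ ({()} : Finset Unit), {y : Fin m₀ → ℝ |
        classifier (Finset.singleton_nonempty ()) (fun (_ : Unit) (_ : Fin m₀ → ℝ) => (1 : ℂ)) y < (fun _ => (1 : ℝ)) i}).indicator
        (1 : (Fin m₀ → ℝ) → ℝ≥0∞) 0 ≠ 0 := by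
  refine ⟨(jco_triple_of_neighbours (𝒱 := Unit) (A := ℂ) ({()} : Finset Unit) (ι := fun _ => Unit)
    (Pu := fun _ => {()}) (fun _ => Finset.singleton_nonempty ()) (fun _ _ _ _ => (1 : ℂ))
    (θ := fun _ => 1) (R := fun _ => 2) (H := fun _ => 0) (δ := fun _ => 0)
    (by simp) (by simp) (by simp) (by simp) (by norm_num)
    (fun i _ V x _ p _ => ⟨fun _ => 0, differentiableOn_const _, fun w _ => by simp, rfl, fun c _ _ => by simp⟩)).2.1, ?_⟩
  have h0 : (0 : Fin m₀ → ℝ) ∈ closedBall (0 : Fin m₀ → ℝ) S ∩ ⋂ i ∈ ({()} : Finset Unit), {y : Fin m₀ → ℝ |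
      classifier (Finset.singleton_nonempty ()) (fun (_ : Unit) (_ : Fin m₀ → ℝ) => (1 : ℂ)) y < (fun _ => (1 : ℝ)) i} := by
    refine ⟨mem_closedBall_self hS, ?_⟩
    simp [classifier]
  rw [indicator_of_mem h0]
  simp

end NonVacuity

end Summit.QuantumFields.BalabanUV.T4Continuum.ShellMeasureCoTestStarShaped

end
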